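import Summits.Ventures.CertifiedManyBodySolver.Theorems.M3x2EdgeSplitSymReplaySoundA
import HarnessLib

/-!
# SymReplay S4 layer B — per-term soundness of the anchored canonicaliser `canonA` (T7; hub-lb-sym-eng-3)
No summit or crux statement is proved here; no certificate beyond toys is replayed; nothing here predicts superconductivity.
-/

noncomputable section

namespace Summit.Ventures.CertifiedManyBodySolver.Theorems.SymReplay

open Matrix Finset
open Literature.MathematicalPhysics.QuantumLattice
open Literature.MathematicalPhysics.QuantumLattice.HubbardWave0
open Literature.MathematicalPhysics.QuantumLattice.ThermodynamicLimit
open Literature.Probability.LatticeModels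
open Literature.MathematicalPhysics.QuantumManyBody.StateRelaxation
open Summit.Ventures.CertifiedManyBodySolver.Theorems.WardSlot
open scoped ComplexOrder BigOperators

/-! ##### (f) Soundness of the anchored canonicaliser, one residual term at a time -/

/-- Helper `anchoredNFs_eq_map` (S4 chain). -/
theorem anchoredNFs_eq_map (corner : Site 2) (frame : List (Site 2)) (u : Word) :
    anchoredNFs corner frame u = (anchoredMoves corner frame u).map Prod.snd := by
  rw [anchoredMoves, List.map_filterMap]
  unfold anchoredNFs
  congr 1
  funext γ
  dsimp only
  split <;> rfl

/-- Helper `mem_anchoredMoves` (S4 chain). -/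
theorem mem_anchoredMoves {corner : Site 2} {frame : List (Site 2)} {u : Word}
    {e : (DihedralGroup 4 × Site 2) × QPoly} (h : e ∈ anchoredMoves corner frame u) :
    e.2 = nfWord (moveWordF e.1.1 e.1.2 u) ∧ suppIn (moveWordF e.1.1 e.1.2 u) frame = true := by
  simp only [anchoredMoves, List.mem_filterMap] at h
  obtain ⟨γ, -, hγ⟩ := h
  split_ifs at hγ with hs
  obtain rfl := Option.some.inj hγ
  exact ⟨rfl, hs⟩

/-- Helper `selBest_cons` (S4 chain). -/
theorem selBest_cons {α : Type*} (e c : α × QPoly) (es : List (α × QPoly)) :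
    selBest e (c :: es) = selBest (if polyKeyLt c.2 e.2 then c else e) es := rfl

/-- Helper `selBest_snd` (S4 chain). -/
theorem selBest_snd {α : Type*} : ∀ (es : List (α × QPoly)) (e : α × QPoly),
    (selBest e es).2 = (es.map Prod.snd).foldl (fun b c => if polyKeyLt c b then c else b) e.2
  | [], _ => rfl
  | c :: es, e => by
    rw [selBest_cons, selBest_snd es, List.map_cons, List.foldl_cons]
    by_cases h : polyKeyLt c.2 e.2 = true
    · rw [if_pos h, if_pos h]
    · rw [if_neg h, if_neg h]

/-- Helper `selBest_mem` (S4 chain). -/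
theorem selBest_mem {α : Type*} : ∀ (es : List (α × QPoly)) (e : α × QPoly), selBest e es ∈ e :: es
  | [], e => List.mem_singleton_self e
  | c :: es, e => by
    rw [selBest_cons]
    by_cases hc : polyKeyLt c.2 e.2 = true
    · rw [if_pos hc]; exact List.mem_cons_of_mem _ (selBest_mem es c)
    · rw [if_neg hc]
      rcases List.mem_cons.1 (selBest_mem es e) with h | h
      · rw [h]; exact List.mem_cons_self
      · exact List.mem_cons_of_mem _ (List.mem_cons_of_mem _ h)

/-- Helper `usesOfTerm_spec` (S4 chain). -/
theorem usesOfTerm_spec {corner : Site 2} {frame : List (Site 2)} {t : ℚ × Word} :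
    ∀ e ∈ usesOfTerm corner frame t, e.u = t.2 ∧ ∃ c ∈ anchoredMoves corner frame t.2, c.1 = (e.γ, e.v) := by
  intro e he
  unfold usesOfTerm at he
  split at he
  · simp at he
  · next e' es hA =>
    have hb : selBest e' es ∈ anchoredMoves corner frame t.2 := hA ▸ selBest_mem es e'
    split at he
    · next c hf =>
      have hc : c ∈ anchoredMoves corner frame t.2 := hA ▸ List.mem_of_find?_eq_some hf
      simp only [List.mem_cons, List.not_mem_nil, or_false] at he
      rcases he with rfl | rfl
      · exact ⟨rfl, _, hb, rfl⟩
      · exact ⟨rfl, _, hc, rfl⟩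
    · simp only [List.mem_singleton] at he
      subst he
      exact ⟨rfl, _, hb, rfl⟩

/-- Helper `usesOfTerm_of_nil` (S4 chain). -/
theorem usesOfTerm_of_nil {corner : Site 2} {frame : List (Site 2)} {t : ℚ × Word}
    (hA : anchoredMoves corner frame t.2 = []) : usesOfTerm corner frame t = [] := by
  unfold usesOfTerm; simp only [hA]

/-- Helper `usesOfTerm_of_none` (S4 chain). -/
theorem usesOfTerm_of_none {corner : Site 2} {frame : List (Site 2)} {t : ℚ × Word}
    {e : (DihedralGroup 4 × Site 2) × QPoly} {es : List ((DihedralGroup 4 × Site 2) × QPoly)}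
    (hA : anchoredMoves corner frame t.2 = e :: es)
    (hf : (e :: es).find? (fun c => polyNegEq (selBest e es).2 c.2) = none) :
    usesOfTerm corner frame t = [⟨-t.1, t.2, (selBest e es).1.1, (selBest e es).1.2⟩] := by
  unfold usesOfTerm; simp only [hA, hf]

/-- Helper `usesOfTerm_of_some` (S4 chain). -/
theorem usesOfTerm_of_some {corner : Site 2} {frame : List (Site 2)} {t : ℚ × Word}
    {e c : (DihedralGroup 4 × Site 2) × QPoly} {es : List ((DihedralGroup 4 × Site 2) × QPoly)}
    (hA : anchoredMoves corner frame t.2 = e :: es)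
    (hf : (e :: es).find? (fun c => polyNegEq (selBest e es).2 c.2) = some c) :
    usesOfTerm corner frame t =
      [⟨-t.1 / 2, t.2, (selBest e es).1.1, (selBest e es).1.2⟩, ⟨-t.1 / 2, t.2, c.1.1, c.1.2⟩] := by
  unfold usesOfTerm; simp only [hA, hf]

/-- Helper `polyOp_of_mem_anchored` (S4 chain). -/
theorem polyOp_of_mem_anchored (h1 : NfFaithful) {Λ' : Finset (Site 2)} {corner : Site 2} {frame : List (Site 2)}
    {u : Word} (hfr : frame.toFinset ⊆ Λ') {e : (DihedralGroup 4 × Site 2) × QPoly}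
    (he : e ∈ anchoredMoves corner frame u) : polyOp Λ' e.2 = wordOp Λ' (moveWord e.1.1 e.1.2 u) := by
  obtain ⟨h2, hs⟩ := mem_anchoredMoves he
  rw [h2, moveWordF_eq]
  rw [moveWordF_eq] at hs
  exact (h1 Λ' _ (((suppIn_iff _ _).1 hs).mono hfr)).symm

/-- **Soundness of `canonTermA` on one residual term**: the canonical form differs from the term by
identification uses, all moves of which fit the frame. -/
theorem canonTermA_sound (h1 : NfFaithful) {Λ' : Finset (Site 2)} (corner : Site 2) (frame : List (Site 2))
    (hfr : frame.toFinset ⊆ Λ') (t : ℚ × Word) :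
    ((t.1 : ℚ) : ℂ) • wordOp Λ' t.2 - polyOp Λ' (canonTermA corner frame t) =
      ((usesOfTerm corner frame t).map (useOp Λ')).sum := by
  unfold canonTermA canonA
  rw [anchoredNFs_eq_map]
  rcases hA : anchoredMoves corner frame t.2 with _ | ⟨e, es⟩
  · rw [usesOfTerm_of_nil hA]
    simp only [List.map_nil, List.sum_nil]
    rw [polyOp_pscale, polyOp_single, Rat.cast_one, one_smul, sub_self]
  · have heA : ∀ c ∈ e :: es, c ∈ anchoredMoves corner frame t.2 := fun c hc => hA ▸ hc
    have hbest : selBest e es ∈ e :: es := selBest_mem es e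
    have hfold : List.foldl (fun b c' => if polyKeyLt c' b then c' else b) e.2 (es.map Prod.snd) =
        (selBest e es).2 := (selBest_snd es e).symm
    have hany : ((e.2 :: es.map Prod.snd).any (polyNegEq (selBest e es).2)) =
        ((e :: es).any fun c => polyNegEq (selBest e es).2 c.2) := by
      rw [← List.map_cons, List.any_map]; rfl
    simp only [List.map_cons, hfold, hany]
    rcases hf : (e :: es).find? (fun c => polyNegEq (selBest e es).2 c.2) with _ | c
    · have hnone : ((e :: es).any fun c => polyNegEq (selBest e es).2 c.2) = false :=
        List.any_eq_false.2 fun c hc => List.find?_eq_none.1 hf c hc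
      rw [usesOfTerm_of_none hA hf]
      simp only [hnone, Bool.false_eq_true, if_false, List.map_cons, List.map_nil, List.sum_cons, List.sum_nil,
        add_zero, useOp]
      rw [polyOp_pscale, polyOp_of_mem_anchored h1 hfr (heA _ hbest)]
      push_cast
      module
    · have hc : c ∈ e :: es := List.mem_of_find?_eq_some hf
      have hpc : polyNegEq (selBest e es).2 c.2 = true := by
        have h := List.find?_some hf
        simpa using h
      have hsome : ((e :: es).any fun c => polyNegEq (selBest e es).2 c.2) = true :=
        List.any_eq_true.2 ⟨c, hc, hpc⟩
      rw [usesOfTerm_of_some hA hf]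
      simp only [hsome, if_true, List.map_cons, List.map_nil, List.sum_cons, List.sum_nil, add_zero, useOp]
      have hneg : wordOp Λ' (moveWord c.1.1 c.1.2 t.2) = -wordOp Λ' (moveWord (selBest e es).1.1 (selBest e es).1.2 t.2) := by
        rw [← polyOp_of_mem_anchored h1 hfr (heA _ hbest), ← polyOp_of_mem_anchored h1 hfr (heA _ hc)]
        exact polyOp_of_polyNegEq Λ' _ _ hpc
      rw [hneg, polyOp_pscale, polyOp_nil, smul_zero, sub_zero]
      push_cast
      module

end Summit.Ventures.CertifiedManyBodySolver.Theorems.SymReplay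

end
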